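import Summits.QuantumFields.YangMills.Theorems.BalabanUVNodesN06Row19LocalClauseAtDirichletInverses
import Literature.MathematicalPhysics.QuantumFieldTheory.Balaban1983to89.B9LocalGaugeZeroModesY
import Literature.MathematicalPhysics.QuantumFieldTheory.Balaban1983to89.Node00.OpsYDeltaALocalProj
import Literature.MathematicalPhysics.QuantumFieldTheory.Balaban1983to89.B9Thm311ProjectionR
import Literature.MathematicalPhysics.QuantumFieldTheory.Balaban1983to89.B9Thm311CoercivePureGaugeAtLettersY

/-!
# BalabanUVNodes ∕ N06 ([B9], `Dag.B9_main`) — ROW 17's LOCAL CLAUSE AT THE FLAT BACKGROUND: [4]'s «G_□(1) is positive» for print's LOCAL bond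
# operator `Δ_{a,□}` at node00-def-Y's FILE 40 letters — `PosDefTr 1 (padDeltaALocY … 1)`, input (i) of the p. 416 road to Cor. 3.6

Track A of `YM-PLAN.md` (cell `pub-ymgap`, HUMAN RULING D-0062), node **N06** = [Balaban1985BackgroundPropagators] Thms 3.1–3.15; seat `pub-ymgap-dag-n06-j`
(bundle F5, rows 15–17), g22.  A HELPER (count-neutral, `--supports` only).

THE PRINT.  [B9] p. 416 (proof of Thm 3.11): *«Thus we have to prove the positivity of G₀. By the definition (3.87) it is enough to prove a positivity of the
operators G_□. Let us consider G_□(U) … by (3.86) we get G_□(e^{iηA}) = G_□(1)(I − V(A)G_□(1))⁻¹. In [4] we have proved that the operator G_□(1) is positive,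
hence by the same reasoning as above we prove positivity of G_□.»*  [4] = [Balaban1984PropagatorsII] Sect. A p. 226: *«the operator Δ_a is bounded from below
by a positive constant»* — on every finite lattice the three squares `‖∂A‖² + ⟨∂*A, R∂*A⟩ + ⟨QA, aQA⟩` of (2.19) have no common zero but `A = 0`.

WHAT.  Row 17 (`hΔA`) is derived from row 19's displayed letters plus the local clause `hGsqA` (this seat's g21 `…N06Row17FromRow19Letters`, consumed by
the knit's ED.34), and `hGsqA` follows at def-Y's `GAsqY` pins from `hloc : … → PosDefTr 1 (padDeltaALocY …)` (`…N06Row19LocalClauseAtDirichletInverses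
.hGsqA_of_GAsqY_pins`).  Print's road to `hloc` (`B9Thm311FromEq3105Schur.localClause_of_perturbation`) has the inputs (i) «G_□(1) ≥ 0» and (ii)+(iii) the
cube-gauge covariance and Sect.-B smallness of `V(A)G_□(1)`.  THIS FILE PROVES (i) AT def-Y's LETTERS, for print's LOCAL operator
`Δ_{a,□}(U) = Δ(U) + D_U R_□(U) D*_U + Q*aQ` of FILE 40 (`OpsYDeltaALocal.deltaALocY`, local gauge projection `R_□ = I − G′_□Q′*C_□Q′G′_□` over the Dirichlet
cube inverse `G′_□ = GsqY`), with no hypothesis beyond the geometry of the cuts: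
* §1 (every `G`-valued `U`, `G ≤ U(N)`): `trIP_RlocY_parSymY_self` ∕ ★ `trIP_RlocY_parSymY_self_nonneg` (`⟨f, R_□f⟩₁ = ‖R_□f‖²₁ ≥ 0`: `R_□` is
  `trIP 1`-symmetric — g21 FILE C §4 — and idempotent on the unit locus — def-Y's `OpsYDeltaALocalProj.RlocY_comp_RlocY` — and the identity off it),
  ★ `trIP_deltaALocY_parSymY_eq` ((3.26)-with-`R_□` as three forms: `⟨A, Δ(U)A⟩₁ + ⟨D*A, R_□D*A⟩₁ + ‖Q(U)A‖²_w`), `trIP_hessY_le_trIP_deltaALocY`;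
* §2 the `M_N(ℂ)` fibre read entrywise: `liftMatY_apply_entry`, `re_liftMatY_apply ∕ im_liftMatY_apply` (a lifted real kernel acts on each real
  coordinate of each matrix entry), `eq_zero_of_entries`;
* §3 ★★ `eq_zero_of_flat_local_zero_modes` — THE FLAT LOCAL ZERO-MODE THEOREM at def-Y's letters: a fine bond field `A` vanishing on every bond inside a
  block not contained in `D`, with `curl₁A = 0`, `Q(1)A = 0` and `R_□(1)D*₁A = 0`, is `0` (entrywise `B9LocalGaugeZeroModesY.exists_local_gauge_potential`
  gives `A = D₁Λ` with `Q′(1)Λ = 0`, `Λ` supported in `D`; then `G′_□(1)D*₁D₁Λ = c_f²Λ` by def-Y's Dirichlet-inverse identity `G′_□·(P_DΔ′_aP_D) = P_D`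
  and [4]'s `Δ′_a = −Δ` on `N(Q′)`, so `Q′G′_□(D*₁A) = 0`, so `R_□` FIXES `D*₁A` (def-Y's `RlocY_apply_of_P_QpY_GsqY_eq_zero`), so `D*₁D₁Λ = 0`, so
  `‖D₁Λ‖²₁ = ⟨Λ, D*₁D₁Λ⟩₁ = 0`);
* §4 ★★★ `posDefTr_deltaALocY_one_of_support` (`⟨B, Δ_{a,□}(1)B⟩₁ > 0` for `B ≠ 0` on the cube's bonds) and ★★★ `posDefTr_padDeltaALocY_one` —
  **`PosDefTr 1 (padDeltaALocY i (parSymY i) (parBY i) D (cutMulY χP) (cutMulY χ) 1)`** for 0∕1-valued block and bond cuts `χP`, `χ` such that every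
  block of `𝔅` containing a `χ`-bond lies in `D` (print's `□ ⊂ □̃`); `isUnit_padDeltaALocY_one`; ★ `localClause_GAsqY_one` — the two conjuncts of `hGsqA`
  (symmetric + positive semi-definite coordinate model of `G_□(1) = GAsqY … 1`) at ANY member, i.e. row 17's local clause INHABITED at `U = 1` (A6).
HONEST FRAMING.  Finite-dimensional linear algebra and lattice cohomology at `U = 1` ([4] Sect. A transported by `B9LocalGaugeZeroModesY`); Cor. 3.6 at
`U ≠ 1` (inputs (ii)–(iii)) NOT proved; nothing of [B9]'s estimates asserted; COUNT-NEUTRAL; N06 NOT discharged; nothing continuum ∕ OS ∕ mass gap ∕ Clay.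
0 `def`, 0 `sorry`.
-/

noncomputable section

namespace Summit.QuantumFields.YangMills.BalabanUVNodes.N06Row17LocalClauseAtFlat

open Literature.MathematicalPhysics.QuantumFieldTheory.Balaban1983to89
open Literature.MathematicalPhysics.QuantumFieldTheory.Balaban1983to89.Node00
open Literature.MathematicalPhysics.QuantumFieldTheory.Balaban1983to89.Node00.OpsYLocalInverse (dirPadY dirInvY GsqY cubeProjY cubeProjY_apply
  GsqY_mul_cubeProjY)
open Literature.MathematicalPhysics.QuantumFieldTheory.Balaban1983to89.Node00.OpsYDeltaALocal (RlocY deltaALocY padDeltaALocY GAsqY padXlocY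
  RlocY_of_not_isUnit)
open Literature.MathematicalPhysics.QuantumFieldTheory.Balaban1983to89.Node00.OpsYDeltaALocalProj (RlocY_comp_RlocY RlocY_apply_of_P_QpY_GsqY_eq_zero)
open Literature.MathematicalPhysics.QuantumFieldTheory.Balaban1983to89.B9Thm311ReadingCoords (trIP PosDefTr IsSymmTr IsAdjTr trIP_zero_right isUnit_of_posDefTr)
open Literature.MathematicalPhysics.QuantumFieldTheory.Balaban1983to89.B9Thm311DeltaPrimePos (trIP_self_nonneg trIP_self_pos trIP_add_right)
open Literature.MathematicalPhysics.QuantumFieldTheory.Balaban1983to89.B9Ineq349SiteAdjoint (trIP_comm)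
open Literature.MathematicalPhysics.QuantumFieldTheory.Balaban1983to89.B9Thm311AdjointPairs (isAdjTr_gradY_divY isAdjTr_QY_QsY_parBY)
open Literature.MathematicalPhysics.QuantumFieldTheory.Balaban1983to89.B9Thm311ProjectionR (trIP_aY_eq)
open Literature.MathematicalPhysics.QuantumFieldTheory.Balaban1983to89.B9Thm311CoercivePureGaugeAtLettersY (trIP_hessY_eq_curl_of_flat)
open Literature.MathematicalPhysics.QuantumFieldTheory.Balaban1983to89.B9Thm311LocalInversePosY (GsqY_mul_compr_deltaPrimeAY_parSymY)
open Literature.MathematicalPhysics.QuantumFieldTheory.Balaban1983to89.B9Thm311PosViaLocalInversesY (trIP_dirPadY_cutMulY_eq cutMulY_mul_self_of_zero_one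
  cutMulY_add_compl)
open Literature.MathematicalPhysics.QuantumFieldTheory.Balaban1983to89.B9Thm37CubeCoverCommutators (cutMulY cutMulY_apply)
open Literature.MathematicalPhysics.QuantumFieldTheory.Balaban1983to89.B9LocalGaugeZeroModesY (exists_local_gauge_potential divK_gradK_mulVec
  mlOpT_mulVec_of_qpK_eq_zero)
open Literature.MathematicalPhysics.QuantumFieldTheory.Balaban1983to89.B6KLevelCensusIndexV1 (KIdx)
open Literature.MathematicalPhysics.QuantumFieldTheory.Balaban1983to89.B6Geom246MultiLevelBox (blkOf)
open OpsYNablaBridge (chartY)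
open Summit.QuantumFields.YangMills.BalabanUVNodes.N06Row19LocalClauseAtDirichletInverses (isSymmTr_RlocY_parSymY)
open scoped Matrix
open scoped Matrix.Norms.L2Operator

variable {N : ℕ} {d ℓ : ℕ} {hd : 1 ≤ d + 1} {hL : Odd (ℓ + 1) ∧ 1 < ℓ + 1} {b₀ b₁ : ℝ} (i : KIdx d ℓ hd hL b₀ b₁)
  {G : Subgroup (Matrix (Fin N) (Fin N) ℂ)ˣ}

/-! ## §1 `R_□(U) ≥ 0` and (3.26)-with-`R_□` as three forms, at every `G`-valued background -/

/-- `⟨f, R_□(U)f⟩₁ = ‖R_□(U)f‖²₁` for a 0∕1-valued block cut: `R_□` is `trIP 1`-symmetric and idempotent (on the unit locus of the padded `X_□`; the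
identity off it). [cite: Balaban1985BackgroundPropagators, (3.20)–(3.21) p.394, (3.25) p.394, (3.105) p.414 (P_□)] -/
theorem trIP_RlocY_parSymY_self (hG : G ≤ B7Prop2Explicit.unitaryUnits (Matrix (Fin N) (Fin N) ℂ)) {U : CfgY (Matrix (Fin N) (Fin N) ℂ) i}
    (hU : ∀ μ x, U μ x ∈ G) (D : Finset (SiteY i)) {χP : BlkY i → ℝ} (hχP : ∀ y, χP y = 0 ∨ χP y = 1)
    (f : SiteY i → Matrix (Fin N) (Fin N) ℂ) :
    trIP (fun _ => (1 : ℝ)) f (RlocY i (parSymY i) D (cutMulY χP) U f)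
      = trIP (fun _ => (1 : ℝ)) (RlocY i (parSymY i) D (cutMulY χP) U f) (RlocY i (parSymY i) D (cutMulY χP) U f) := by
  by_cases hu : IsUnit (padXlocY i (parSymY i) D (cutMulY (𝔸 := Matrix (Fin N) (Fin N) ℂ) χP) U)
  · have h := isSymmTr_RlocY_parSymY i hG hU D χP f (RlocY i (parSymY i) D (cutMulY χP) U f)
    rw [← LinearMap.comp_apply, RlocY_comp_RlocY i (parSymY i) D (cutMulY_mul_self_of_zero_one hχP) hu] at h
    exact h.symm
  · rw [RlocY_of_not_isUnit i (parSymY i) D hu, LinearMap.id_apply]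

/-- ★ hence `⟨f, R_□(U)f⟩₁ ≥ 0`. [cite: Balaban1985BackgroundPropagators, (3.20)–(3.21) p.394, (3.25) p.394] -/
theorem trIP_RlocY_parSymY_self_nonneg (hG : G ≤ B7Prop2Explicit.unitaryUnits (Matrix (Fin N) (Fin N) ℂ))
    {U : CfgY (Matrix (Fin N) (Fin N) ℂ) i} (hU : ∀ μ x, U μ x ∈ G) (D : Finset (SiteY i)) {χP : BlkY i → ℝ}
    (hχP : ∀ y, χP y = 0 ∨ χP y = 1) (f : SiteY i → Matrix (Fin N) (Fin N) ℂ) :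
    0 ≤ trIP (fun _ => (1 : ℝ)) f (RlocY i (parSymY i) D (cutMulY χP) U f) := by
  rw [trIP_RlocY_parSymY_self i hG hU D hχP]
  exact trIP_self_nonneg _ (fun _ => one_pos) _

/-- ★ **(3.26) WITH THE LOCAL GAUGE PROJECTION, AS QUADRATIC FORMS**: `⟨A, Δ_{a,□}(U)A⟩₁ = ⟨A, Δ(U)A⟩₁ + ⟨D*_UA, R_□(U)D*_UA⟩₁ + ‖Q(U)A‖²_w` at every
`G`-valued `U` (`D_U ∕ D*_U` and `Q ∕ Q*` adjoint pairs for the trace pairing; any block cut `P`). [cite: Balaban1985BackgroundPropagators, (3.26) p.395, (3.105) p.414, (3.8) p.392, (3.13) p.393] -/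
theorem trIP_deltaALocY_parSymY_eq (hG : G ≤ B7Prop2Explicit.unitaryUnits (Matrix (Fin N) (Fin N) ℂ)) {U : CfgY (Matrix (Fin N) (Fin N) ℂ) i}
    (hU : ∀ μ x, U μ x ∈ G) (D : Finset (SiteY i)) (P : Module.End ℂ (BlkY i → Matrix (Fin N) (Fin N) ℂ))
    (A : FBondY i → Matrix (Fin N) (Fin N) ℂ) :
    trIP (fun _ => (1 : ℝ)) A (deltaALocY i (parSymY i) (parBY i) D P U A)
      = trIP (fun _ => (1 : ℝ)) A (hessY i U A)
        + trIP (fun _ => (1 : ℝ)) (divY i U A) (RlocY i (parSymY i) D P U (divY i U A))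
        + trIP i.w (QY i (parBY i) U A) (QY i (parBY i) U A) := by
  have hU' : ∀ μ x, ((U μ x : (Matrix (Fin N) (Fin N) ℂ)ˣ) : Matrix (Fin N) (Fin N) ℂ) ∈ unitary (Matrix (Fin N) (Fin N) ℂ) :=
    fun μ x => hG (hU μ x)
  rw [deltaALocY, LinearMap.add_apply, LinearMap.add_apply, trIP_add_right, trIP_add_right]
  congr 1
  · congr 1
    rw [LinearMap.comp_apply, LinearMap.comp_apply, trIP_comm, isAdjTr_gradY_divY i U hU', trIP_comm]
  · rw [LinearMap.comp_apply, LinearMap.comp_apply, ← isAdjTr_QY_QsY_parBY i hG U hU, trIP_aY_eq]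

/-- `⟨A, Δ(U)A⟩₁ ≤ ⟨A, Δ_{a,□}(U)A⟩₁` for a 0∕1-valued block cut. [cite: Balaban1985BackgroundPropagators, (3.26) p.395, Thm 3.11 p.416] -/
theorem trIP_hessY_le_trIP_deltaALocY (hG : G ≤ B7Prop2Explicit.unitaryUnits (Matrix (Fin N) (Fin N) ℂ))
    {U : CfgY (Matrix (Fin N) (Fin N) ℂ) i} (hU : ∀ μ x, U μ x ∈ G) (D : Finset (SiteY i)) {χP : BlkY i → ℝ}
    (hχP : ∀ y, χP y = 0 ∨ χP y = 1) (A : FBondY i → Matrix (Fin N) (Fin N) ℂ) :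
    trIP (fun _ => (1 : ℝ)) A (hessY i U A) ≤ trIP (fun _ => (1 : ℝ)) A (deltaALocY i (parSymY i) (parBY i) D (cutMulY χP) U A) := by
  rw [trIP_deltaALocY_parSymY_eq i hG hU D (cutMulY χP) A, add_assoc]
  exact le_add_of_nonneg_right (add_nonneg (trIP_RlocY_parSymY_self_nonneg i hG hU D hχP _) (trIP_self_nonneg _ i.hw _))

/-! ## §2 The `M_N(ℂ)` fibre, entrywise -/

section Entries

variable {X Y : Type} [Fintype X]

/-- a lifted real kernel acts on each matrix entry: `(M♯Φ)(y)_{ab} = Σ_x M(y,x)·Φ(x)_{ab}`. [cite: Balaban1985BackgroundPropagators, p.395 («It coincides with Δ_a in (2.19) if U = 1»), bookkeeping] -/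
theorem liftMatY_apply_entry (M : Matrix Y X ℝ) (Φ : X → Matrix (Fin N) (Fin N) ℂ) (y : Y) (a b : Fin N) :
    liftMatY (Matrix (Fin N) (Fin N) ℂ) M Φ y a b = ∑ x, ((M y x : ℝ) : ℂ) * Φ x a b := by
  rw [liftMatY_apply, Matrix.sum_apply]
  exact Finset.sum_congr rfl fun x _ => rfl

/-- … so on the REAL PART of an entry it is the real kernel: `Re (M♯Φ)(·)_{ab} = M·(Re Φ(·)_{ab})`. [cite: Balaban1985BackgroundPropagators, p.395, bookkeeping] -/
theorem re_liftMatY_apply (M : Matrix Y X ℝ) (Φ : X → Matrix (Fin N) (Fin N) ℂ) (a b : Fin N) :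
    (fun y => (liftMatY (Matrix (Fin N) (Fin N) ℂ) M Φ y a b).re) = M *ᵥ fun x => (Φ x a b).re := by
  funext y
  rw [liftMatY_apply_entry, Complex.re_sum, Matrix.mulVec, dotProduct]
  exact Finset.sum_congr rfl fun x _ => Complex.re_ofReal_mul _ _

/-- … and on the IMAGINARY PART: `Im (M♯Φ)(·)_{ab} = M·(Im Φ(·)_{ab})`. [cite: Balaban1985BackgroundPropagators, p.395, bookkeeping] -/
theorem im_liftMatY_apply (M : Matrix Y X ℝ) (Φ : X → Matrix (Fin N) (Fin N) ℂ) (a b : Fin N) :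
    (fun y => (liftMatY (Matrix (Fin N) (Fin N) ℂ) M Φ y a b).im) = M *ᵥ fun x => (Φ x a b).im := by
  funext y
  rw [liftMatY_apply_entry, Complex.im_sum, Matrix.mulVec, dotProduct]
  exact Finset.sum_congr rfl fun x _ => Complex.im_ofReal_mul _ _

omit [Fintype X] in
/-- a matrix-valued lattice function vanishes iff all real coordinates of all its entries do. [folklore] -/
theorem eq_zero_of_entries {Φ : X → Matrix (Fin N) (Fin N) ℂ} (hre : ∀ a b x, (Φ x a b).re = 0) (him : ∀ a b x, (Φ x a b).im = 0) : Φ = 0 := by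
  funext x; ext a b; exact Complex.ext (hre a b x) (him a b x)

omit [Fintype X] in
/-- two matrix-valued lattice functions agree iff all real coordinates of all their entries do. [folklore] -/
theorem eq_of_entries {Φ Ψ : X → Matrix (Fin N) (Fin N) ℂ} (hre : ∀ a b x, (Φ x a b).re = (Ψ x a b).re)
    (him : ∀ a b x, (Φ x a b).im = (Ψ x a b).im) : Φ = Ψ := by
  funext x; ext a b; exact Complex.ext (hre a b x) (him a b x)

omit [Fintype X] in
/-- the real coordinates of the entries of a real multiple. [folklore] -/
theorem re_smul_apply (r : ℝ) (Φ : X → Matrix (Fin N) (Fin N) ℂ) (x : X) (a b : Fin N) :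
    ((((r : ℝ) : ℂ) • Φ) x a b).re = r * (Φ x a b).re := by
  rw [Pi.smul_apply, Matrix.smul_apply, smul_eq_mul, Complex.re_ofReal_mul]

omit [Fintype X] in
/-- the imaginary coordinates of the entries of a real multiple. [folklore] -/
theorem im_smul_apply (r : ℝ) (Φ : X → Matrix (Fin N) (Fin N) ℂ) (x : X) (a b : Fin N) :
    ((((r : ℝ) : ℂ) • Φ) x a b).im = r * (Φ x a b).im := by
  rw [Pi.smul_apply, Matrix.smul_apply, smul_eq_mul, Complex.im_ofReal_mul]

end Entries

/-! ## §3 The flat local zero-mode theorem at def-Y's letters -/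

/-- at `U = 1`: `D*₁D₁Λ = c_f²·Δ′_a(1)Λ` for a potential in the gauge space (`Q′(1)Λ = 0`) — `∂*∂ = c_f²(−Δ^{per})` and [4]'s `Δ′_a = −Δ^{per}` on `N(Q′)`,
read entrywise in the fibre. [cite: Balaban1984PropagatorsII, (2.13)–(2.14) p.225; Balaban1985BackgroundPropagators, (3.8) p.392, (3.24) p.394] -/
theorem divY_gradY_one_eq_smul_deltaPrimeAY {Λ : SiteY i → Matrix (Fin N) (Fin N) ℂ}
    (hQ : QpY i (parSymY i) (fun _ _ => 1) Λ = 0) :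
    divY i (fun _ _ => 1) (gradY i (fun _ _ => 1) Λ) = (((i.cf ^ 2 : ℝ)) : ℂ) • deltaPrimeAY i (parSymY i) (fun _ _ => 1) Λ := by
  have hq : ∀ a b : Fin N, qpK i *ᵥ (fun z => (Λ z a b).re) = 0 ∧ qpK i *ᵥ (fun z => (Λ z a b).im) = 0 := by
    intro a b
    rw [QpY_one i (parSymY_one i)] at hQ
    exact ⟨by rw [← re_liftMatY_apply, hQ]; funext y; simp, by rw [← im_liftMatY_apply, hQ]; funext y; simp⟩
  rw [gradY_one, divY_one, deltaPrimeAY_one i (parSymY i) (parSymY_one i), liftOpY_eq_liftMatY]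
  refine eq_of_entries (fun a b z => ?_) (fun a b z => ?_)
  · rw [re_smul_apply]
    have h1 := congrFun (re_liftMatY_apply (divK i) (liftMatY (Matrix (Fin N) (Fin N) ℂ) (gradK i) Λ) a b) z
    have h2 := congrFun (re_liftMatY_apply
      (B6MultiLevelTorusOperator.mlOpT (toKT i).NB ℓ (toKT i).k (toKT i).D.lev (B6MultiLevelBoxOperator.aPrinted ℓ 1)) Λ a b) z
    rw [h1, h2, re_liftMatY_apply, divK_gradK_mulVec]
    show (i.cf ^ 2 • (B6MultiLevelTorusOperator.perLapT (B6MultiLevelBoxOperator.N0 ℓ i.Mh i.k i.P') *ᵥ fun x => (Λ x a b).re)) z = _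
    rw [Pi.smul_apply, smul_eq_mul]
    congr 1
    exact (congrFun (mlOpT_mulVec_of_qpK_eq_zero i (B6MultiLevelBoxOperator.aPrinted ℓ 1) (hq a b).1) z).symm
  · rw [im_smul_apply]
    have h1 := congrFun (im_liftMatY_apply (divK i) (liftMatY (Matrix (Fin N) (Fin N) ℂ) (gradK i) Λ) a b) z
    have h2 := congrFun (im_liftMatY_apply
      (B6MultiLevelTorusOperator.mlOpT (toKT i).NB ℓ (toKT i).k (toKT i).D.lev (B6MultiLevelBoxOperator.aPrinted ℓ 1)) Λ a b) z
    rw [h1, h2, im_liftMatY_apply, divK_gradK_mulVec]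
    show (i.cf ^ 2 • (B6MultiLevelTorusOperator.perLapT (B6MultiLevelBoxOperator.N0 ℓ i.Mh i.k i.P') *ᵥ fun x => (Λ x a b).im)) z = _
    rw [Pi.smul_apply, smul_eq_mul]
    congr 1
    exact (congrFun (mlOpT_mulVec_of_qpK_eq_zero i (B6MultiLevelBoxOperator.aPrinted ℓ 1) (hq a b).2) z).symm

/-- at `U = 1`: the Dirichlet cube inverse inverts `Δ′_a(1)` on functions supported in `□̃ = D` — `G′_□(1)(Δ′_a(1)Λ) = Λ` for `P_DΛ = Λ` (def-Y's
`G′_□·(P_DΔ′_aP_D) = P_D`, unconditional at `parSymY`). [cite: Balaban1985BackgroundPropagators, pp.408–409 (G′_□), (3.24)–(3.25) pp.394–395] -/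
theorem GsqY_one_deltaPrimeAY_apply_of_support (D : Finset (SiteY i)) {Λ : SiteY i → Matrix (Fin N) (Fin N) ℂ}
    (hΛ : cubeProjY i D Λ = Λ) :
    GsqY i (parSymY i) D (fun _ _ => 1) (deltaPrimeAY i (parSymY i) (fun _ _ => 1) Λ) = Λ := by
  have hU : ∀ (μ : Fin (d + 1)) (x : Site (B6GlobalChartV1.PV d ℓ i.m i.K hd hL) 0),
      (fun (_ : Fin (d + 1)) (_ : Site (B6GlobalChartV1.PV d ℓ i.m i.K hd hL) 0) => (1 : (Matrix (Fin N) (Fin N) ℂ)ˣ)) μ x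
        ∈ (⊥ : Subgroup (Matrix (Fin N) (Fin N) ℂ)ˣ) := fun _ _ => Subgroup.one_mem _
  have h := GsqY_mul_compr_deltaPrimeAY_parSymY i (G := ⊥) bot_le hU D
  have h' := congrArg (fun T => T Λ) h
  simp only [Module.End.mul_apply] at h'
  rw [hΛ] at h'
  rwa [← GsqY_mul_cubeProjY, Module.End.mul_apply]

/-- ★★ **THE FLAT LOCAL ZERO-MODE THEOREM** at def-Y's letters: a fine bond field `A` that vanishes on every bond lying inside a block of `𝔅` not
contained in `D`, with `curl₁A = 0`, `Q(1)A = 0` and `R_□(1)(D*₁A) = 0` (`R_□` over the Dirichlet cube inverse `G′_□` on `D` and ANY idempotent block cut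
`P`), vanishes.  ([4]: the three squares of `⟨A, Δ_aA⟩` have no common zero; here for the LOCAL operator: `A = D₁Λ`, `Λ ∈ N(Q′)` supported in `D`,
`G′_□D*₁D₁Λ = c_f²Λ`, so `R_□` fixes `D*₁A`, so `D*₁D₁Λ = 0`, so `‖D₁Λ‖² = 0`.) [cite: Balaban1984PropagatorsII, (2.19)–(2.22) p.226; Balaban1985BackgroundPropagators, Thm 3.11 proof p.416, pp.408–409] -/
theorem eq_zero_of_flat_local_zero_modes (D : Finset (SiteY i)) {P : Module.End ℂ (BlkY i → Matrix (Fin N) (Fin N) ℂ)} (hP : P * P = P)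
    {A : FBondY i → Matrix (Fin N) (Fin N) ℂ}
    (hA : ∀ z : SiteY i, z ∉ D → ∀ b : FBondY i, blkOf i.D.toDomains (chartY i b.src) = blkOf i.D.toDomains z →
      blkOf i.D.toDomains (chartY i b.tgt) = blkOf i.D.toDomains z → A b = 0)
    (hcurl : curlY i (fun _ _ => 1) A = 0) (hQ : QY i (parBY i) (fun _ _ => 1) A = 0)
    (hR : RlocY i (parSymY i) D P (fun _ _ => 1) (divY i (fun _ _ => 1) A) = 0) : A = 0 := by
  -- the real coordinates of the entries of `A` are curl-free constrained bond fields
  have hc : ∀ a b : Fin N, curlK i *ᵥ (fun x => (A x a b).re) = 0 ∧ curlK i *ᵥ (fun x => (A x a b).im) = 0 := by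
    intro a b
    rw [curlY_one] at hcurl
    exact ⟨by rw [← re_liftMatY_apply, hcurl]; funext y; simp, by rw [← im_liftMatY_apply, hcurl]; funext y; simp⟩
  have hq : ∀ a b : Fin N, qK i *ᵥ (fun x => (A x a b).re) = 0 ∧ qK i *ᵥ (fun x => (A x a b).im) = 0 := by
    intro a b
    rw [QY_one i (parBY_one i)] at hQ
    exact ⟨by rw [← re_liftMatY_apply, hQ]; funext y; simp, by rw [← im_liftMatY_apply, hQ]; funext y; simp⟩
  -- entrywise local gauge potentials
  choose φr hφr using fun a b : Fin N => exists_local_gauge_potential i (hc a b).1 (hq a b).1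
  choose φi hφi using fun a b : Fin N => exists_local_gauge_potential i (hc a b).2 (hq a b).2
  -- the fibre-valued potential
  let Λ : SiteY i → Matrix (Fin N) (Fin N) ℂ := fun z => Matrix.of fun a b => ⟨φr a b z, φi a b z⟩
  have hΛre : ∀ a b z, (Λ z a b).re = φr a b z := fun _ _ _ => rfl
  have hΛim : ∀ a b z, (Λ z a b).im = φi a b z := fun _ _ _ => rfl
  -- `A = D₁Λ`
  have hgrad : gradY i (fun _ _ => 1) Λ = A := by
    rw [gradY_one]
    refine eq_of_entries (fun a b x => ?_) (fun a b x => ?_)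
    · have h := congrFun (re_liftMatY_apply (gradK i) Λ a b) x
      rw [h, show (fun z => (Λ z a b).re) = φr a b from funext (hΛre a b), (hφr a b).2.1]
    · have h := congrFun (im_liftMatY_apply (gradK i) Λ a b) x
      rw [h, show (fun z => (Λ z a b).im) = φi a b from funext (hΛim a b), (hφi a b).2.1]
  -- `Q′(1)Λ = 0`
  have hQp : QpY i (parSymY i) (fun _ _ => 1) Λ = 0 := by
    rw [QpY_one i (parSymY_one i)]
    refine eq_zero_of_entries (fun a b y => ?_) (fun a b y => ?_)
    · have h := congrFun (re_liftMatY_apply (qpK i) Λ a b) y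
      rw [h, show (fun z => (Λ z a b).re) = φr a b from funext (hΛre a b), (hφr a b).1, Pi.zero_apply]
    · have h := congrFun (im_liftMatY_apply (qpK i) Λ a b) y
      rw [h, show (fun z => (Λ z a b).im) = φi a b from funext (hΛim a b), (hφi a b).1, Pi.zero_apply]
  -- `Λ` is supported in `D`
  have hsupp : cubeProjY i D Λ = Λ := by
    funext z
    rw [cubeProjY_apply]
    split_ifs with hz
    · rfl
    · symm; ext a b
      refine Complex.ext ?_ ?_
      · rw [hΛre, Matrix.zero_apply, Complex.zero_re]
        exact (hφr a b).2.2 z fun bnd hs ht => by rw [hA z hz bnd hs ht, Matrix.zero_apply, Complex.zero_re]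
      · rw [hΛim, Matrix.zero_apply, Complex.zero_im]
        exact (hφi a b).2.2 z fun bnd hs ht => by rw [hA z hz bnd hs ht, Matrix.zero_apply, Complex.zero_im]
  -- `G′_□(1)(D*₁A) = c_f²Λ`, so its block averages vanish and `R_□` fixes `D*₁A`
  have hψ : divY i (fun _ _ => 1) A = (((i.cf ^ 2 : ℝ)) : ℂ) • deltaPrimeAY i (parSymY i) (fun _ _ => 1) Λ := by
    rw [← hgrad]
    exact divY_gradY_one_eq_smul_deltaPrimeAY i hQp
  have hfix : RlocY i (parSymY i) D P (fun _ _ => 1) (divY i (fun _ _ => 1) A) = divY i (fun _ _ => 1) A := by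
    refine RlocY_apply_of_P_QpY_GsqY_eq_zero i (parSymY i) D hP _ ?_
    rw [hψ, map_smul, GsqY_one_deltaPrimeAY_apply_of_support i D hsupp, map_smul, hQp, smul_zero, map_zero]
  have hdiv : divY i (fun _ _ => 1) A = 0 := by rw [← hfix, hR]
  -- `‖D₁Λ‖²₁ = ⟨Λ, D*₁D₁Λ⟩₁ = 0`
  have hU' : ∀ (μ : Fin (d + 1)) (x : Site (B6GlobalChartV1.PV d ℓ i.m i.K hd hL) 0),
      (((fun (_ : Fin (d + 1)) (_ : Site (B6GlobalChartV1.PV d ℓ i.m i.K hd hL) 0) => (1 : (Matrix (Fin N) (Fin N) ℂ)ˣ)) μ x :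
        (Matrix (Fin N) (Fin N) ℂ)ˣ) : Matrix (Fin N) (Fin N) ℂ) ∈ unitary (Matrix (Fin N) (Fin N) ℂ) := fun _ _ => by
    simp only [Units.val_one]
    exact Submonoid.one_mem _
  have h0 : trIP (fun _ => (1 : ℝ)) A A = 0 := by
    have h := isAdjTr_gradY_divY i (fun _ _ => 1) hU' Λ A
    rw [hgrad, hdiv, trIP_zero_right] at h
    exact h
  by_contra hA0
  exact (trIP_self_pos (fun _ => (1 : ℝ)) (fun _ => one_pos) hA0).ne' h0

/-! ## §4 ★★★ «G_□(1) is positive»: the local bond operator and its padded compression are positive definite at the flat background -/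

/-- the trivial configuration takes values in the trivial subgroup. [cite: Balaban1985BackgroundPropagators, p.395 (U = 1), bookkeeping] -/
theorem cfg_one_mem_bot (μ : Fin (d + 1)) (x : Site (B6GlobalChartV1.PV d ℓ i.m i.K hd hL) 0) :
    (fun (_ : Fin (d + 1)) (_ : Site (B6GlobalChartV1.PV d ℓ i.m i.K hd hL) 0) => (1 : (Matrix (Fin N) (Fin N) ℂ)ˣ)) μ x
      ∈ (⊥ : Subgroup (Matrix (Fin N) (Fin N) ℂ)ˣ) :=
  Subgroup.one_mem _

/-- the trivial configuration is unitary-valued. [cite: Balaban1985BackgroundPropagators, p.395 (U = 1), bookkeeping] -/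
theorem cfg_one_mem_unitary (μ : Fin (d + 1)) (x : Site (B6GlobalChartV1.PV d ℓ i.m i.K hd hL) 0) :
    (((fun (_ : Fin (d + 1)) (_ : Site (B6GlobalChartV1.PV d ℓ i.m i.K hd hL) 0) => (1 : (Matrix (Fin N) (Fin N) ℂ)ˣ)) μ x :
      (Matrix (Fin N) (Fin N) ℂ)ˣ) : Matrix (Fin N) (Fin N) ℂ) ∈ unitary (Matrix (Fin N) (Fin N) ℂ) := by
  simp only [Units.val_one]
  exact Submonoid.one_mem _

/-- ★★★ **`⟨B, Δ_{a,□}(1)B⟩₁ > 0` FOR EVERY NON-ZERO `B` VANISHING ON THE BONDS INSIDE THE BLOCKS NOT CONTAINED IN `D`** (in particular for every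
non-zero `B` supported on the bonds of a cube `□` all of whose blocks lie in `□̃ = D`): the three flat forms `‖curl₁B‖²₁ + ⟨D*₁B, R_□(1)D*₁B⟩₁ + ‖Q(1)B‖²_w`
are non-negative and have no common zero but `B = 0` (§3).  [4]'s «Δ_a is positive» for print's LOCAL operator of Sect. C at def-Y's letters.
[cite: Balaban1984PropagatorsII, (2.19)–(2.22) p.226; Balaban1985BackgroundPropagators, Thm 3.11 proof p.416 («In [4] we have proved that the operator G_□(1) is positive»), pp.408–409] -/
theorem posDefTr_deltaALocY_one_of_support (D : Finset (SiteY i)) {χP : BlkY i → ℝ} (hχP : ∀ y, χP y = 0 ∨ χP y = 1)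
    {B : FBondY i → Matrix (Fin N) (Fin N) ℂ} (hB0 : B ≠ 0)
    (hB : ∀ z : SiteY i, z ∉ D → ∀ b : FBondY i, blkOf i.D.toDomains (chartY i b.src) = blkOf i.D.toDomains z →
      blkOf i.D.toDomains (chartY i b.tgt) = blkOf i.D.toDomains z → B b = 0) :
    0 < trIP (fun _ => (1 : ℝ)) B (deltaALocY i (parSymY i) (parBY i) D (cutMulY χP) (fun _ _ => 1) B) := by
  have hG1 : (⊥ : Subgroup (Matrix (Fin N) (Fin N) ℂ)ˣ) ≤ B7Prop2Explicit.unitaryUnits (Matrix (Fin N) (Fin N) ℂ) := bot_le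
  rw [trIP_deltaALocY_parSymY_eq i hG1 (cfg_one_mem_bot i) D (cutMulY χP) B,
    trIP_hessY_eq_curl_of_flat i (cfg_one_mem_unitary i) (holY_one i) B]
  have h1 := trIP_self_nonneg (fun _ => (1 : ℝ)) (fun _ => one_pos) (curlY i (fun _ _ => 1) B)
  have h2 := trIP_RlocY_parSymY_self_nonneg i hG1 (cfg_one_mem_bot i) D hχP (divY i (fun _ _ => 1) B)
  have h3 := trIP_self_nonneg i.w i.hw (QY i (parBY i) (fun _ _ => 1) B)
  by_contra hle
  push Not at hle
  have e1 : trIP (fun _ => (1 : ℝ)) (curlY i (fun _ _ => 1) B) (curlY i (fun _ _ => 1) B) = 0 := by linarith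
  have e2 : trIP (fun _ => (1 : ℝ)) (divY i (fun _ _ => 1) B)
      (RlocY i (parSymY i) D (cutMulY χP) (fun _ _ => 1) (divY i (fun _ _ => 1) B)) = 0 := by linarith
  have e3 : trIP i.w (QY i (parBY i) (fun _ _ => 1) B) (QY i (parBY i) (fun _ _ => 1) B) = 0 := by linarith
  have hcurl : curlY i (fun _ _ => 1) B = 0 := by by_contra h; exact (trIP_self_pos _ (fun _ => one_pos) h).ne' e1
  have hQ : QY i (parBY i) (fun _ _ => 1) B = 0 := by by_contra h; exact (trIP_self_pos i.w i.hw h).ne' e3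
  have hR : RlocY i (parSymY i) D (cutMulY χP) (fun _ _ => 1) (divY i (fun _ _ => 1) B) = 0 := by
    rw [trIP_RlocY_parSymY_self i hG1 (cfg_one_mem_bot i) D hχP] at e2
    by_contra h; exact (trIP_self_pos _ (fun _ => one_pos) h).ne' e2
  exact hB0 (eq_zero_of_flat_local_zero_modes i D (cutMulY_mul_self_of_zero_one hχP) hB hcurl hQ hR)

/-- ★★★ **«G_□(1) IS POSITIVE» AT node00-def-Y's FILE 40 LETTERS**: for 0∕1-valued block and bond cut-offs `χP`, `χ` such that every block of `𝔅` containing a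
`χ`-bond (both ends in the block) lies in the cube site set `D` (print's `□ ⊂ □̃`), the padded compression `M_χΔ_{a,□}(1)M_χ + (1 − M_χ)` of print's local
bond operator is positive definite for the trace pairing — the hypothesis `hloc` of `…N06Row19LocalClauseAtDirichletInverses.hGsqA_of_GAsqY_pins` AT `U = 1`,
i.e. input (i) of the p. 416 road `B9Thm311FromEq3105Schur.localClause_of_perturbation`; hence `G_□(1) = GAsqY … 1` is the genuine padded inverse, `≥ 0`.
[cite: Balaban1985BackgroundPropagators, Thm 3.11 proof p.416, Cor. 3.6 p.408 (at U = 1: Cor. 3.5 p.407 «proved in [4]»), pp.408–409 (G_□); Balaban1984PropagatorsII, p.226, p.228] -/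
theorem posDefTr_padDeltaALocY_one (D : Finset (SiteY i)) {χP : BlkY i → ℝ} (hχP : ∀ y, χP y = 0 ∨ χP y = 1)
    {χ : FBondY i → ℝ} (hχ : ∀ b, χ b = 0 ∨ χ b = 1)
    (hD : ∀ z : SiteY i, z ∉ D → ∀ b : FBondY i, blkOf i.D.toDomains (chartY i b.src) = blkOf i.D.toDomains z →
      blkOf i.D.toDomains (chartY i b.tgt) = blkOf i.D.toDomains z → χ b = 0) :
    PosDefTr (fun _ => (1 : ℝ))
      (padDeltaALocY i (parSymY i) (parBY i) D (cutMulY χP) (cutMulY χ) (fun _ _ => 1 : CfgY (Matrix (Fin N) (Fin N) ℂ) i)) := by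
  intro Φ hΦ
  rw [OpsYDeltaALocal.padDeltaALocY_eq_dirPadY, trIP_dirPadY_cutMulY_eq (fun _ => (1 : ℝ)) hχ]
  by_cases hB : cutMulY χ Φ = 0
  · have hrest : cutMulY (fun z => 1 - χ z) Φ = Φ := by
      have h := cutMulY_add_compl (N := N) χ Φ
      rwa [hB, zero_add] at h
    rw [hB, map_zero, trIP_zero_right, zero_add, hrest]
    exact trIP_self_pos _ (fun _ => one_pos) hΦ
  · refine add_pos_of_pos_of_nonneg (posDefTr_deltaALocY_one_of_support i D hχP hB fun z hz b hs ht => ?_)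
      (trIP_self_nonneg _ (fun _ => one_pos) _)
    rw [cutMulY_apply, hD z hz b hs ht, Complex.ofReal_zero, zero_smul]

/-- hence the padded `Δ_{a,□}(1)` is a unit: `G_□(1) = GAsqY … 1` is its genuine inverse on the cube's bonds.
[cite: Balaban1985BackgroundPropagators, pp.408–409 (G_□), Thm 3.3 p.399 (at U = 1: [4] p.226)] -/
theorem isUnit_padDeltaALocY_one (D : Finset (SiteY i)) {χP : BlkY i → ℝ} (hχP : ∀ y, χP y = 0 ∨ χP y = 1)
    {χ : FBondY i → ℝ} (hχ : ∀ b, χ b = 0 ∨ χ b = 1)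
    (hD : ∀ z : SiteY i, z ∉ D → ∀ b : FBondY i, blkOf i.D.toDomains (chartY i b.src) = blkOf i.D.toDomains z →
      blkOf i.D.toDomains (chartY i b.tgt) = blkOf i.D.toDomains z → χ b = 0) :
    IsUnit (padDeltaALocY i (parSymY i) (parBY i) D (cutMulY χP) (cutMulY χ) (fun _ _ => 1 : CfgY (Matrix (Fin N) (Fin N) ℂ) i)) :=
  isUnit_of_posDefTr (posDefTr_padDeltaALocY_one i D hχP hχ hD)

open Literature.MathematicalPhysics.QuantumFieldTheory.Balaban1983to89.B9CoReadingCoords (coordOpK)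
open Literature.MathematicalPhysics.QuantumFieldTheory.Balaban1983to89.B9CoReadingCoordsTranspose (TrIdx trBasis)
open Literature.MathematicalPhysics.QuantumFieldTheory.Balaban1983to89.B9Thm37Glue (IsTransposePair)
open Summit.QuantumFields.YangMills.BalabanUVNodes.N06Row19LocalClauseAtDirichletInverses (localClause_coordOpK_dirInvY isSymmTr_deltaALocY_parSymY)

/-- ★ **ROW 17's LOCAL CLAUSE INHABITED AT `U = 1`** (A6 column): the scaled coordinate model of def-Y's local bond inverse `G_□(1) = GAsqY … 1` over the trace
basis is self-transpose and positive semi-definite — the two conjuncts of the certificate's `hGsqA` at the flat background, for any index, cube data as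
above and scale `c ≥ 0` (the `hloc` input of `hGsqA_of_GAsqY_pins` is `posDefTr_padDeltaALocY_one`, the symmetry input is g21's `isSymmTr_deltaALocY_parSymY`).
[cite: Balaban1985BackgroundPropagators, Thm 3.11 p.416 («positivity of the operators G_□»), Cor. 3.5 p.407, pp.408–409; Balaban1984PropagatorsII, p.228 («The operator G is positive»)] -/
theorem localClause_GAsqY_one {Dd : Type} [Fintype Dd] (D : Finset (SiteY i)) {χP : BlkY i → ℝ} (hχP : ∀ y, χP y = 0 ∨ χP y = 1)
    {χ : FBondY i → ℝ} (hχ : ∀ b, χ b = 0 ∨ χ b = 1)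
    (hD : ∀ z : SiteY i, z ∉ D → ∀ b : FBondY i, blkOf i.D.toDomains (chartY i b.src) = blkOf i.D.toDomains z →
      blkOf i.D.toDomains (chartY i b.tgt) = blkOf i.D.toDomains z → χ b = 0) {c : ℝ} (hc : 0 ≤ c) :
    IsTransposePair
        (c • coordOpK (trBasis N) (fun _ : Dd =>
          (GAsqY i (parSymY i) (parBY i) D (cutMulY χP) (cutMulY χ) (fun _ _ => 1 : CfgY (Matrix (Fin N) (Fin N) ℂ) i)).restrictScalars ℝ))
        (c • coordOpK (trBasis N) (fun _ : Dd =>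
          (GAsqY i (parSymY i) (parBY i) D (cutMulY χP) (cutMulY χ) (fun _ _ => 1 : CfgY (Matrix (Fin N) (Fin N) ℂ) i)).restrictScalars ℝ)) ∧
      ∀ v : FBondY i × Dd × TrIdx N × TrIdx N → ℝ,
        0 ≤ v ⬝ᵥ (c • coordOpK (trBasis N) (fun _ : Dd =>
          (GAsqY i (parSymY i) (parBY i) D (cutMulY χP) (cutMulY χ) (fun _ _ => 1 : CfgY (Matrix (Fin N) (Fin N) ℂ) i)).restrictScalars ℝ)) v :=
  localClause_coordOpK_dirInvY (D := Dd) χ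
    (isSymmTr_deltaALocY_parSymY i (G := ⊥) bot_le (cfg_one_mem_bot i) D χP) (posDefTr_padDeltaALocY_one i D hχP hχ hD) hc

end Summit.QuantumFields.YangMills.BalabanUVNodes.N06Row17LocalClauseAtFlat

end
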